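import Mathlib.Analysis.Convolution
import Mathlib.MeasureTheory.Function.ConvergenceInMeasure
import Mathlib.MeasureTheory.Function.LpSeminorm.CompareExp
import Mathlib.MeasureTheory.Integral.MeanInequalities
import Mathlib.Analysis.InnerProductSpace.PiL2
import Mathlib.MeasureTheory.Group.Measure
import Mathlib.MeasureTheory.Measure.Lebesgue.EqHaar
import Mathlib.MeasureTheory.Measure.Haar.Unique
import HarnessLib

/-!
# Limits of weighted bilinear integrals, sliced convergence, and sliced bounds under mollification

Analysis/FluidPDE support file (serves the discharge of `NS.ess_suitable_of_L3infty'`,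
Escauriaza–Seregin–Šverák 2003, proof of Thm. 1.4: the passage to the limit in the mollified
local energy identity). Generic measure-theoretic tools, all proved:

* `tendsto_eLpNorm_bilin_sub` — if `Aₙ → A` in `L^p` and `Bₙ → B` in `L^q` then
  `β(Aₙ, Bₙ) → β(A, B)` in `L^r`, `1/p + 1/q = 1/r`, for a bounded bilinear `β` (Hölder);
  `memLp_bilin`, `integrable_bilin_of_memLp`, `integrable_mul_bilin_of_memLp`,
  `integrable_clm_bilin_of_memLp`;
* `tendsto_setIntegral_mul_of_tendsto_eLpNorm_one`, `tendsto_setIntegral_mul_bilin`,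
  `tendsto_setIntegral_clm_apply_of_tendsto_eLpNorm_one`, `tendsto_setIntegral_clm_bilin` —
  weighted (scalar or functional weight) set integrals pass to `L¹` limits;
* `exists_subseq_tendsto_eLpNorm_slice` — space–time `L²` convergence gives sliced `L²`
  convergence for a.e. time along a subsequence (Tonelli, convergence in measure);
* `lintegral_mul_rpow_le_of_unit_mass` (Jensen for a unit-mass kernel) and
  `lintegral_rpow_slice_convolution_le` — sliced `L^q` bounds survive space–time
  mollification (ESS §3: the mollified field keeps its `L_{3,∞}` bound).

## Mathlib search

Mathlib (this pin) has Hölder's inequality for elementwise operations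
(`eLpNorm_le_eLpNorm_mul_eLpNorm_of_nnnorm` with `ENNReal.HolderTriple`), `tendsto_integral_of_L1`,
convergence in measure and a.e.-convergent subsequences (`tendstoInMeasure_of_tendsto_eLpNorm`,
`TendstoInMeasure.exists_seq_tendsto_ae`), Tonelli (`lintegral_prod`,
`AEMeasurable.lintegral_prod_right'`) and `L^p` monotonicity on probability spaces; the
combinations above are not in Mathlib (searched `tendsto`/`bilin`/`convolution` in
`MeasureTheory/Function`, `Analysis/Convolution`).

## References

* L. Escauriaza, G. Seregin, V. Šverák, *`L_{3,∞}`-solutions of Navier–Stokes equations and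
  backward uniqueness*, Russ. Math. Surveys 58:2 (2003), §3, proof of Thm. 1.4, first paragraph.
* L. C. Evans, *Partial Differential Equations*, 2nd ed. (2010), App. C.4, Thm. 7.
-/

noncomputable section

open MeasureTheory TopologicalSpace Set Function Filter Topology ContinuousLinearMap Metric
open scoped ENNReal NNReal Convolution

namespace Literature.Analysis.FluidPDE

/-! ### Products of `L^p`-convergent sequences -/

section LpProducts

variable {X : Type*} [MeasurableSpace X] {μ : Measure X}
variable {E₁ E₂ E₃ : Type*} [NormedAddCommGroup E₁] [NormedSpace ℝ E₁] [NormedAddCommGroup E₂]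
  [NormedSpace ℝ E₂] [NormedAddCommGroup E₃] [NormedSpace ℝ E₃]

/-- **Hölder for a bounded bilinear map**: `‖β(A, B)‖_r ≤ ‖β‖ ‖A‖_p ‖B‖_q` for `1/p + 1/q = 1/r`. [folklore] -/
theorem eLpNorm_bilin_le {p q r : ℝ≥0∞} [ENNReal.HolderTriple p q r] (β : E₁ →L[ℝ] E₂ →L[ℝ] E₃)
    {A : X → E₁} {B : X → E₂} (hA : AEStronglyMeasurable A μ) (hB : AEStronglyMeasurable B μ) :
    eLpNorm (fun x => β (A x) (B x)) r μ ≤ (‖β‖₊ : ℝ≥0∞) * eLpNorm A p μ * eLpNorm B q μ :=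
  eLpNorm_le_eLpNorm_mul_eLpNorm_of_nnnorm hA hB (fun a b => β a b) ‖β‖₊
    (Eventually.of_forall fun x => β.le_opNorm₂ (A x) (B x))

/-- **Products of convergent sequences converge.** If `Aₙ → A` in `L^p`, `Bₙ → B` in `L^q` with
`A ∈ L^p`, `B ∈ L^q`, `1 ≤ q`, `1 ≤ r` and `1/p + 1/q = 1/r`, then `β(Aₙ, Bₙ) → β(A, B)` in `L^r`
for every bounded bilinear `β` (Hölder applied to `β(Aₙ - A, Bₙ) + β(A, Bₙ - B)`). [folklore] -/
theorem tendsto_eLpNorm_bilin_sub {p q r : ℝ≥0∞} [ENNReal.HolderTriple p q r] (hq : 1 ≤ q)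
    (hr : 1 ≤ r) (β : E₁ →L[ℝ] E₂ →L[ℝ] E₃)
    {A : ℕ → X → E₁} {A₀ : X → E₁} {B : ℕ → X → E₂} {B₀ : X → E₂}
    (hAm : ∀ n, AEStronglyMeasurable (A n) μ) (hA₀m : AEStronglyMeasurable A₀ μ)
    (hBm : ∀ n, AEStronglyMeasurable (B n) μ) (hB₀m : AEStronglyMeasurable B₀ μ)
    (hA₀ : eLpNorm A₀ p μ < ∞) (hB₀ : eLpNorm B₀ q μ < ∞)
    (hA : Tendsto (fun n => eLpNorm (A n - A₀) p μ) atTop (𝓝 0))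
    (hB : Tendsto (fun n => eLpNorm (B n - B₀) q μ) atTop (𝓝 0)) :
    Tendsto (fun n => eLpNorm (fun x => β (A n x) (B n x) - β (A₀ x) (B₀ x)) r μ) atTop (𝓝 0) := by
  set M : ℝ≥0∞ := (‖β‖₊ : ℝ≥0∞) with hM
  -- the bound
  have hbound : ∀ n, eLpNorm (fun x => β (A n x) (B n x) - β (A₀ x) (B₀ x)) r μ ≤
      M * eLpNorm (A n - A₀) p μ * (eLpNorm (B n - B₀) q μ + eLpNorm B₀ q μ) +
        M * eLpNorm A₀ p μ * eLpNorm (B n - B₀) q μ := by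
    intro n
    have hsplit : (fun x => β (A n x) (B n x) - β (A₀ x) (B₀ x)) =
        (fun x => β ((A n - A₀) x) (B n x)) + fun x => β (A₀ x) ((B n - B₀) x) := by
      funext x
      simp only [Pi.add_apply, Pi.sub_apply, map_sub, _root_.sub_apply]
      abel
    rw [hsplit]
    refine (eLpNorm_add_le ?_ ?_ hr).trans (add_le_add ?_ ?_)
    · exact β.continuous₂.comp_aestronglyMeasurable (((hAm n).sub hA₀m).prodMk (hBm n))
    · exact β.continuous₂.comp_aestronglyMeasurable (hA₀m.prodMk ((hBm n).sub hB₀m))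
    · refine (eLpNorm_bilin_le (p := p) (q := q) β ((hAm n).sub hA₀m) (hBm n)).trans ?_
      gcongr
      have : B n = (B n - B₀) + B₀ := by funext x; simp
      conv_lhs => rw [this]
      exact eLpNorm_add_le ((hBm n).sub hB₀m) hB₀m hq
    · exact eLpNorm_bilin_le (p := p) (q := q) β hA₀m ((hBm n).sub hB₀m)
  -- the bound tends to zero
  have hlim : Tendsto (fun n => M * eLpNorm (A n - A₀) p μ * (eLpNorm (B n - B₀) q μ + eLpNorm B₀ q μ) +
      M * eLpNorm A₀ p μ * eLpNorm (B n - B₀) q μ) atTop (𝓝 0) := by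
    have h1 : Tendsto (fun n => M * eLpNorm (A n - A₀) p μ * (eLpNorm (B n - B₀) q μ + eLpNorm B₀ q μ))
        atTop (𝓝 (M * 0 * (0 + eLpNorm B₀ q μ))) := by
      refine ENNReal.Tendsto.mul (ENNReal.Tendsto.const_mul hA (Or.inr ENNReal.coe_ne_top)) ?_
        (hB.add tendsto_const_nhds) ?_
      · exact Or.inr (by simpa using hB₀.ne)
      · exact Or.inr (by simp)
    have h2 : Tendsto (fun n => M * eLpNorm A₀ p μ * eLpNorm (B n - B₀) q μ) atTop
        (𝓝 (M * eLpNorm A₀ p μ * 0)) :=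
      ENNReal.Tendsto.const_mul hB (Or.inr (ENNReal.mul_ne_top ENNReal.coe_ne_top hA₀.ne))
    simpa using h1.add h2
  exact tendsto_of_tendsto_of_tendsto_of_le_of_le tendsto_const_nhds hlim (fun n => zero_le) hbound

omit [NormedSpace ℝ E₁] in
/-- An `L^p`-convergent sequence with limit in `L^p` is eventually (indeed always, once the
distance is finite) in `L^p`: `‖Aₙ‖_p < ∞` for all large `n`. [folklore] -/
theorem eventually_eLpNorm_lt_top_of_tendsto {p : ℝ≥0∞} (hp : 1 ≤ p) {A : ℕ → X → E₁} {A₀ : X → E₁}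
    (hAm : ∀ n, AEStronglyMeasurable (A n) μ) (hA₀m : AEStronglyMeasurable A₀ μ)
    (hA₀ : eLpNorm A₀ p μ < ∞) (hA : Tendsto (fun n => eLpNorm (A n - A₀) p μ) atTop (𝓝 0)) :
    ∀ᶠ n in atTop, eLpNorm (A n) p μ < ∞ := by
  have h1 : ∀ᶠ n in atTop, eLpNorm (A n - A₀) p μ < 1 :=
    (tendsto_order.1 hA).2 1 zero_lt_one
  filter_upwards [h1] with n hn
  have : A n = (A n - A₀) + A₀ := by funext x; simp
  rw [this]
  exact (eLpNorm_add_le ((hAm n).sub hA₀m) hA₀m hp).trans_lt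
    (ENNReal.add_lt_top.2 ⟨hn.trans ENNReal.one_lt_top, hA₀⟩)

end LpProducts

/-! ### Weighted integrals of `L¹`-convergent sequences -/

section Weighted

variable {X : Type*} [MeasurableSpace X] {μ : Measure X}

/-- **Weighted set integrals pass to `L¹` limits**: if `Φₙ → Φ` in `L¹(μ)` and `w` is a bounded
a.e.-strongly measurable weight, then `∫_S w Φₙ → ∫_S w Φ` for every measurable `S`. [folklore] -/
theorem tendsto_setIntegral_mul_of_tendsto_eLpNorm_one {Φ : ℕ → X → ℝ} {Φ₀ : X → ℝ} {w : X → ℝ}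
    {C : ℝ} (hw : AEStronglyMeasurable w μ) (hwC : ∀ᵐ x ∂μ, ‖w x‖ ≤ C)
    (hΦ : ∀ n, Integrable (Φ n) μ) (hΦ₀ : Integrable Φ₀ μ)
    (h : Tendsto (fun n => eLpNorm (Φ n - Φ₀) 1 μ) atTop (𝓝 0)) (S : Set X) :
    Tendsto (fun n => ∫ x in S, w x * Φ n x ∂μ) atTop (𝓝 (∫ x in S, w x * Φ₀ x ∂μ)) := by
  set C' : ℝ≥0 := C.toNNReal with hC'
  have hwC' : ∀ᵐ x ∂μ, ‖w x‖₊ ≤ C' := by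
    filter_upwards [hwC] with x hx
    change ‖w x‖ ≤ (C.toNNReal : ℝ)
    exact hx.trans (Real.le_coe_toNNReal C)
  refine tendsto_integral_of_L1 (μ := μ.restrict S) (fun x => w x * Φ₀ x)
    (hw.mul hΦ₀.1).restrict (Eventually.of_forall fun n =>
      (hΦ n).restrict.bdd_mul hw.restrict (ae_restrict_of_ae hwC)) ?_
  have hb : ∀ n, ∫⁻ x in S, ‖w x * Φ n x - w x * Φ₀ x‖ₑ ∂μ ≤ C' * eLpNorm (Φ n - Φ₀) 1 μ := by
    intro n
    rw [eLpNorm_one_eq_lintegral_enorm]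
    calc ∫⁻ x in S, ‖w x * Φ n x - w x * Φ₀ x‖ₑ ∂μ
        ≤ ∫⁻ x in S, C' * ‖(Φ n - Φ₀) x‖ₑ ∂μ := by
          refine lintegral_mono_ae ((ae_restrict_of_ae hwC').mono fun x hx => ?_)
          rw [← mul_sub, enorm_mul, Pi.sub_apply]
          gcongr
          rw [enorm_eq_nnnorm]
          exact_mod_cast hx
      _ = C' * ∫⁻ x in S, ‖(Φ n - Φ₀) x‖ₑ ∂μ := by
          rw [lintegral_const_mul' _ _ ENNReal.coe_ne_top]
      _ ≤ C' * ∫⁻ x, ‖(Φ n - Φ₀) x‖ₑ ∂μ := by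
          gcongr
          exact Measure.restrict_le_self
  have hlim : Tendsto (fun n => (C' : ℝ≥0∞) * eLpNorm (Φ n - Φ₀) 1 μ) atTop (𝓝 0) := by
    simpa using ENNReal.Tendsto.const_mul h (Or.inr ENNReal.coe_ne_top)
  exact tendsto_of_tendsto_of_tendsto_of_le_of_le tendsto_const_nhds hlim (fun n => zero_le) hb

end Weighted

/-! ### `L²` norms as `lintegral`s -/

section L2

variable {X : Type*} [MeasurableSpace X] {μ : Measure X} {F : Type*} [NormedAddCommGroup F]

/-- `‖f‖_{L²}² = ∫⁻ ‖f‖ₑ²`. [folklore] -/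
theorem MollifiedLimits.eLpNorm_two_pow_two (f : X → F) : eLpNorm f 2 μ ^ 2 = ∫⁻ x, ‖f x‖ₑ ^ 2 ∂μ := by
  have h := eLpNorm_nnreal_pow_eq_lintegral (f := f) (μ := μ) (p := (2 : ℝ≥0)) two_ne_zero
  simp only [ENNReal.coe_ofNat, NNReal.coe_ofNat, ENNReal.rpow_two] at h
  exact h

/-- `‖f‖_{L²} = (∫⁻ ‖f‖ₑ²)^{1/2}`. [folklore] -/
theorem eLpNorm_two_eq_rpow (f : X → F) : eLpNorm f 2 μ = (∫⁻ x, ‖f x‖ₑ ^ 2 ∂μ) ^ (1 / 2 : ℝ) := by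
  rw [← MollifiedLimits.eLpNorm_two_pow_two, ← ENNReal.rpow_natCast, ← ENNReal.rpow_mul]
  norm_num

/-- `‖f‖_{Lⁿ}ⁿ = ∫⁻ ‖f‖ₑⁿ` for a natural exponent `n ≠ 0`. [folklore] -/
theorem eLpNorm_natCast_pow_eq_lintegral' (f : X → F) {n : ℕ} (hn : n ≠ 0) :
    eLpNorm f n μ ^ n = ∫⁻ x, ‖f x‖ₑ ^ n ∂μ := by
  have h := eLpNorm_nnreal_pow_eq_lintegral (f := f) (μ := μ) (p := (n : ℝ≥0))
    (by exact_mod_cast hn)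
  simp only [ENNReal.coe_natCast, NNReal.coe_natCast, ENNReal.rpow_natCast] at h
  exact h

end L2

/-! ### Sliced `L²` convergence along a subsequence -/

section Sliced

variable {Y : Type*} [MeasurableSpace Y] {ν : Measure Y} [SFinite ν]
variable {F : Type*} [NormedAddCommGroup F]

/-- **From space–time `L²` convergence to sliced `L²` convergence a.e. in time, along a
subsequence.** If `Dₙ → 0` in `L²(dt ⊗ ν)` (each `Dₙ` a.e.-strongly measurable with
`‖Dₙ‖_{L²} < ∞`), then along some subsequence `‖Dₙₖ(s, ·)‖_{L²(ν)} → 0` for a.e. `s`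
(Tonelli makes `s ↦ ‖Dₙ(s, ·)‖²_{L²(ν)}` converge to `0` in `L¹(dt)`, hence in measure, hence
a.e. along a subsequence). [folklore] -/
theorem exists_subseq_tendsto_eLpNorm_slice {D : ℕ → ℝ × Y → F}
    (hm : ∀ n, AEStronglyMeasurable (D n) ((volume : Measure ℝ).prod ν))
    (hfin : ∀ n, eLpNorm (D n) 2 ((volume : Measure ℝ).prod ν) < ∞)
    (h : Tendsto (fun n => eLpNorm (D n) 2 ((volume : Measure ℝ).prod ν)) atTop (𝓝 0)) :
    ∃ ns : ℕ → ℕ, StrictMono ns ∧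
      ∀ᵐ s : ℝ, Tendsto (fun k => eLpNorm (fun y => D (ns k) (s, y)) 2 ν) atTop (𝓝 0) := by
  -- the sliced squared norms `e n s = ∫⁻ ‖Dₙ(s, y)‖ₑ² dν`
  set e : ℕ → ℝ → ℝ≥0∞ := fun n s => ∫⁻ y, ‖D n (s, y)‖ₑ ^ 2 ∂ν with he
  have hDm : ∀ n, AEMeasurable (fun z => ‖D n z‖ₑ ^ 2) ((volume : Measure ℝ).prod ν) := fun n =>
    (hm n).enorm.pow_const 2
  have he_m : ∀ n, AEMeasurable (e n) volume := fun n => (hDm n).lintegral_prod_right'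
  have he_int : ∀ n, ∫⁻ s, e n s = eLpNorm (D n) 2 ((volume : Measure ℝ).prod ν) ^ 2 := fun n => by
    rw [MollifiedLimits.eLpNorm_two_pow_two, lintegral_prod _ (hDm n)]
  have he_fin : ∀ n, ∀ᵐ s, e n s < ∞ := fun n =>
    ae_lt_top' (he_m n) (by rw [he_int]; exact ENNReal.pow_ne_top (hfin n).ne)
  -- the real-valued versions converge to `0` in `L¹(dt)`
  set g : ℕ → ℝ → ℝ := fun n s => (e n s).toReal with hg
  have hg_m : ∀ n, AEStronglyMeasurable (g n) volume := fun n =>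
    (he_m n).ennreal_toReal.aestronglyMeasurable
  have hg1 : ∀ n, eLpNorm (g n - 0) 1 volume = ∫⁻ s, e n s := fun n => by
    rw [sub_zero, eLpNorm_one_eq_lintegral_enorm]
    refine lintegral_congr_ae ((he_fin n).mono fun s hs => ?_)
    change ‖(e n s).toReal‖ₑ = e n s
    rw [Real.enorm_eq_ofReal ENNReal.toReal_nonneg, ENNReal.ofReal_toReal hs.ne]
  have hlim : Tendsto (fun n => eLpNorm (g n - 0) 1 volume) atTop (𝓝 0) := by
    simp_rw [hg1, he_int]
    have h0 : Tendsto (fun n => eLpNorm (D n) 2 ((volume : Measure ℝ).prod ν) ^ 2) atTop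
        (𝓝 ((0 : ℝ≥0∞) ^ 2)) := ((ENNReal.continuous_pow 2).tendsto 0).comp h
    rwa [zero_pow two_ne_zero] at h0
  have hmeas := tendstoInMeasure_of_tendsto_eLpNorm one_ne_zero hg_m
    (aestronglyMeasurable_const (b := (0 : ℝ))) hlim
  obtain ⟨ns, hns, hae⟩ := hmeas.exists_seq_tendsto_ae
  refine ⟨ns, hns, ?_⟩
  have hall : ∀ᵐ s, ∀ n, e n s < ∞ := ae_all_iff.2 he_fin
  filter_upwards [hae, hall] with s hs hs'
  have h1 : Tendsto (fun k => e (ns k) s) atTop (𝓝 0) := by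
    have h2 : (fun k => e (ns k) s) = fun k => ENNReal.ofReal (g (ns k) s) := by
      funext k; rw [hg, ENNReal.ofReal_toReal (hs' _).ne]
    rw [h2, ← ENNReal.ofReal_zero]
    exact ENNReal.tendsto_ofReal hs
  have h3 : (fun k => eLpNorm (fun y => D (ns k) (s, y)) 2 ν) = fun k => (e (ns k) s) ^ (1 / 2 : ℝ) := by
    funext k; rw [eLpNorm_two_eq_rpow]
  rw [h3]
  have h4 : Tendsto (fun k => e (ns k) s ^ (1 / 2 : ℝ)) atTop (𝓝 ((0 : ℝ≥0∞) ^ (1 / 2 : ℝ))) :=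
    (ENNReal.continuous_rpow_const.tendsto 0).comp h1
  rwa [ENNReal.zero_rpow_of_pos (by norm_num : (0 : ℝ) < 1 / 2)] at h4

end Sliced

/-! ### Sliced `L^q` bounds survive mollification (Jensen) -/

section Jensen

variable {Y : Type*} [NormedAddCommGroup Y] [NormedSpace ℝ Y] [FiniteDimensional ℝ Y]
  [MeasurableSpace Y] [BorelSpace Y]
variable {F : Type*} [NormedAddCommGroup F] [NormedSpace ℝ F]

/-- **Jensen for a unit-mass kernel**: for `k ≥ 0` continuous with compact support and
`∫ k = 1`, `g` measurable and `1 ≤ q`,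
`(∫⁻ ‖k‖ₑ g)^q ≤ ∫⁻ ‖k‖ₑ g^q` (monotonicity of `L^p` norms for the probability measure
`k dw`). [folklore] -/
theorem lintegral_mul_rpow_le_of_unit_mass {W : Type*} [MeasurableSpace W] {μ : Measure W}
    {k : W → ℝ} (hk0 : ∀ w, 0 ≤ k w) (hkm : Measurable k) (hk1 : ∫⁻ w, ‖k w‖ₑ ∂μ = 1)
    {g : W → ℝ≥0∞} (hg : AEMeasurable g μ) {q : ℝ} (hq : 1 ≤ q) :
    (∫⁻ w, ‖k w‖ₑ * g w ∂μ) ^ q ≤ ∫⁻ w, ‖k w‖ₑ * g w ^ q ∂μ := by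
  have _ := hk0
  set κ : Measure W := μ.withDensity fun w => ‖k w‖ₑ with hκ
  haveI : IsProbabilityMeasure κ := ⟨by rw [hκ, withDensity_apply _ MeasurableSet.univ,
    Measure.restrict_univ, hk1]⟩
  have hkm' : Measurable fun w => ‖k w‖ₑ := hkm.enorm
  have h1 : ∫⁻ w, ‖k w‖ₑ * g w ∂μ = ∫⁻ w, g w ∂κ := by
    rw [hκ, lintegral_withDensity_eq_lintegral_mul₀ hkm'.aemeasurable hg]
    rfl
  have h2 : ∫⁻ w, ‖k w‖ₑ * g w ^ q ∂μ = ∫⁻ w, g w ^ q ∂κ := by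
    rw [hκ, lintegral_withDensity_eq_lintegral_mul₀ hkm'.aemeasurable (hg.pow_const q)]
    rfl
  rw [h1, h2]
  -- monotonicity of `L^p(κ)` norms applied to the real function `(g w).toReal`? Work in `ℝ≥0∞`:
  -- use the `eLpNorm` of the `ℝ≥0∞`-valued function through `g.toNNReal` after truncation.
  have hgκ : AEMeasurable g κ := hg.mono_ac (withDensity_absolutelyContinuous _ _)
  have hq0 : 0 < q := one_pos.trans_le hq
  -- Jensen in the form `∫ g ≤ (∫ g^q)^(1/q)` for a probability measure
  rcases hq.eq_or_lt with rfl | hq1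
  · simp only [ENNReal.rpow_one]; exact le_rfl
  have key : ∫⁻ w, g w ∂κ ≤ (∫⁻ w, g w ^ q ∂κ) ^ (1 / q) := by
    have h := ENNReal.lintegral_mul_le_Lp_mul_Lq κ (Real.HolderConjugate.conjExponent hq1) hgκ
      (aemeasurable_const (b := (1 : ℝ≥0∞)))
    simp only [Pi.mul_apply, mul_one, ENNReal.one_rpow, lintegral_const, measure_univ,
      mul_one] at h
    exact h
  calc (∫⁻ w, g w ∂κ) ^ q ≤ ((∫⁻ w, g w ^ q ∂κ) ^ (1 / q)) ^ q := by gcongr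
    _ = ∫⁻ w, g w ^ q ∂κ := by
        rw [← ENNReal.rpow_mul, one_div, inv_mul_cancel₀ hq0.ne', ENNReal.rpow_one]

end Jensen

/-! ### Sliced `L^q` bounds survive space–time mollification -/

section SlicedBound

variable {Y : Type*} [NormedAddCommGroup Y] [NormedSpace ℝ Y] [FiniteDimensional ℝ Y]
  [MeasureSpace Y] [BorelSpace Y] [(volume : Measure Y).IsAddHaarMeasure]
variable {F : Type*} [NormedAddCommGroup F] [NormedSpace ℝ F]

/-- **Sliced `L^q` bounds survive mollification.** Let `k ≥ 0` be a continuous compactly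
supported kernel on `ℝ × Y` with `∫ k = 1`, `f` strongly measurable, and `1 ≤ q`. If `∫ ‖f(s, y)‖^q dy ≤ C` for a.e. `s`, then `∫ ‖(k ⋆ f)(s, y)‖^q dy ≤ C` for **every**
`s` (Jensen for the probability measure `k dw`, Tonelli, and translation invariance in `y`;
Escauriaza–Seregin–Šverák 2003, §3: the mollified field keeps the `L_{3,∞}` bound). [folklore] -/
theorem lintegral_rpow_slice_convolution_le {k : ℝ × Y → ℝ} (hk0 : ∀ w, 0 ≤ k w)
    (hkc : Continuous k) (hks : HasCompactSupport k) (hk1 : ∫ w, k w = 1)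
    {f : ℝ × Y → F} (hf : StronglyMeasurable f) {q : ℝ} (hq : 1 ≤ q) {C : ℝ≥0∞} (hC : ∀ᵐ s : ℝ, ∫⁻ y, ‖f (s, y)‖ₑ ^ q ≤ C) (s : ℝ) :
    ∫⁻ y, ‖(k ⋆[lsmul ℝ ℝ, volume] f) (s, y)‖ₑ ^ q ≤ C := by
  have hq0 : 0 < q := one_pos.trans_le hq
  have hkm : Measurable k := hkc.measurable
  have hk1' : ∫⁻ w, ‖k w‖ₑ = 1 := by
    have h : ∀ w, ‖k w‖ₑ = ENNReal.ofReal (k w) := fun w => Real.enorm_eq_ofReal (hk0 w)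
    simp_rw [h]
    rw [← ofReal_integral_eq_lintegral_ofReal (hkc.integrable_of_hasCompactSupport hks)
      (Eventually.of_forall hk0), hk1, ENNReal.ofReal_one]
  have hfe : Measurable fun z => ‖f z‖ₑ := hf.enorm
  -- Steps 1–2: pointwise Jensen bound
  have hpt : ∀ z : ℝ × Y, ‖(k ⋆[lsmul ℝ ℝ, volume] f) z‖ₑ ^ q ≤
      ∫⁻ w, ‖k w‖ₑ * ‖f (z - w)‖ₑ ^ q := by
    intro z
    have h1 : ‖(k ⋆[lsmul ℝ ℝ, volume] f) z‖ₑ ≤ ∫⁻ w, ‖k w‖ₑ * ‖f (z - w)‖ₑ := by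
      rw [convolution_def]
      refine (enorm_integral_le_lintegral_enorm _).trans (le_of_eq ?_)
      refine lintegral_congr fun w => ?_
      rw [lsmul_apply, enorm_smul]
    have hgm : AEMeasurable (fun w => ‖f (z - w)‖ₑ) (volume : Measure (ℝ × Y)) :=
      (hfe.comp (measurable_const.sub measurable_id)).aemeasurable
    exact (ENNReal.rpow_le_rpow h1 hq0.le).trans (lintegral_mul_rpow_le_of_unit_mass hk0 hkm hk1' hgm hq)
  -- Step 3: integrate in `y` and swap
  have hm2 : Measurable fun p : Y × (ℝ × Y) => ‖k p.2‖ₑ * ‖f ((s, p.1) - p.2)‖ₑ ^ q := by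
    refine (hkm.enorm.comp measurable_snd).mul ((hfe.comp ?_).pow_const q)
    exact ((measurable_const.prodMk measurable_fst).sub measurable_snd)
  calc ∫⁻ y, ‖(k ⋆[lsmul ℝ ℝ, volume] f) (s, y)‖ₑ ^ q
      ≤ ∫⁻ y, ∫⁻ w, ‖k w‖ₑ * ‖f ((s, y) - w)‖ₑ ^ q := lintegral_mono fun y => hpt (s, y)
    _ = ∫⁻ w, ∫⁻ y, ‖k w‖ₑ * ‖f ((s, y) - w)‖ₑ ^ q :=
        lintegral_lintegral_swap hm2.aemeasurable
    _ = ∫⁻ w, ‖k w‖ₑ * ∫⁻ y, ‖f (s - w.1, y)‖ₑ ^ q := by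
        refine lintegral_congr fun w => ?_
        have hm3 : Measurable fun y : Y => ‖f ((s, y) - w)‖ₑ ^ q :=
          (hfe.comp ((measurable_const.prodMk measurable_id).sub measurable_const)).pow_const q
        rw [lintegral_const_mul _ hm3]
        congr 1
        exact lintegral_sub_right_eq_self (fun y => ‖f (s - w.1, y)‖ₑ ^ q) w.2
    _ ≤ ∫⁻ w, ‖k w‖ₑ * C := by
        refine lintegral_mono_ae ?_
        -- transport the a.e.-in-`s` bound along `w ↦ s - w.1`
        have hqmp : Measure.QuasiMeasurePreserving (fun w : ℝ × Y => s - w.1)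
            (volume : Measure (ℝ × Y)) (volume : Measure ℝ) := by
          have h1 : Measure.QuasiMeasurePreserving (Prod.fst : ℝ × Y → ℝ)
              (volume : Measure (ℝ × Y)) volume := by
            rw [Measure.volume_eq_prod]; exact Measure.quasiMeasurePreserving_fst
          exact (Measure.measurePreserving_sub_left (volume : Measure ℝ) s).quasiMeasurePreserving.comp h1
        filter_upwards [hqmp.ae hC] with w hw
        gcongr
    _ = C := by rw [lintegral_mul_const _ hkm.enorm, hk1', one_mul]

end SlicedBound

/-! ### Integrability and limits of bilinear expressions -/

section Bilin

variable {X : Type*} [MeasurableSpace X] {μ : Measure X}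
variable {E₁ E₂ : Type*} [NormedAddCommGroup E₁] [NormedSpace ℝ E₁] [NormedAddCommGroup E₂]
  [NormedSpace ℝ E₂]

/-- `β(A, B)` is integrable for `A ∈ L^p`, `B ∈ L^q`, `1/p + 1/q = 1` and a bounded bilinear
real form `β` (Hölder). [folklore] -/
theorem integrable_bilin_of_memLp {p q : ℝ≥0∞} [ENNReal.HolderTriple p q 1]
    (β : E₁ →L[ℝ] E₂ →L[ℝ] ℝ) {A : X → E₁} {B : X → E₂} (hA : MemLp A p μ) (hB : MemLp B q μ) :
    Integrable (fun x => β (A x) (B x)) μ := by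
  refine memLp_one_iff_integrable.1 ⟨?_, ?_⟩
  · exact β.continuous₂.comp_aestronglyMeasurable (hA.1.prodMk hB.1)
  · refine (eLpNorm_bilin_le (p := p) (q := q) β hA.1 hB.1).trans_lt ?_
    exact ENNReal.mul_lt_top (ENNReal.mul_lt_top ENNReal.coe_lt_top hA.eLpNorm_lt_top)
      hB.eLpNorm_lt_top

/-- **Weighted integrals of bilinear expressions pass to the limit.** If `Aₙ → A` in `L^p`,
`Bₙ → B` in `L^q` (`1 ≤ q`, `1/p + 1/q = 1`, all terms in the respective classes), `β` is a
bounded bilinear real form and `w` a bounded weight, then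
`∫_S w β(Aₙ, Bₙ) → ∫_S w β(A, B)`. [folklore] -/
theorem tendsto_setIntegral_mul_bilin {p q : ℝ≥0∞} [ENNReal.HolderTriple p q 1] (hq : 1 ≤ q)
    (β : E₁ →L[ℝ] E₂ →L[ℝ] ℝ) {A : ℕ → X → E₁} {A₀ : X → E₁} {B : ℕ → X → E₂} {B₀ : X → E₂}
    (hA : ∀ n, MemLp (A n) p μ) (hA₀ : MemLp A₀ p μ) (hB : ∀ n, MemLp (B n) q μ)
    (hB₀ : MemLp B₀ q μ)
    (hAt : Tendsto (fun n => eLpNorm (A n - A₀) p μ) atTop (𝓝 0))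
    (hBt : Tendsto (fun n => eLpNorm (B n - B₀) q μ) atTop (𝓝 0))
    {w : X → ℝ} {C : ℝ} (hw : AEStronglyMeasurable w μ) (hwC : ∀ᵐ x ∂μ, ‖w x‖ ≤ C) (S : Set X) :
    Tendsto (fun n => ∫ x in S, w x * β (A n x) (B n x) ∂μ) atTop
      (𝓝 (∫ x in S, w x * β (A₀ x) (B₀ x) ∂μ)) := by
  refine tendsto_setIntegral_mul_of_tendsto_eLpNorm_one hw hwC
    (fun n => integrable_bilin_of_memLp β (hA n) (hB n)) (integrable_bilin_of_memLp β hA₀ hB₀)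
    ?_ S
  have h := tendsto_eLpNorm_bilin_sub (p := p) (q := q) (r := 1) hq le_rfl β
    (fun n => (hA n).1) hA₀.1 (fun n => (hB n).1) hB₀.1 hA₀.eLpNorm_lt_top hB₀.eLpNorm_lt_top
    hAt hBt
  exact h

/-- `L^r` convergence of bilinear expressions in `MemLp` form: under the hypotheses of
`tendsto_eLpNorm_bilin_sub`, `β(Aₙ, Bₙ) - β(A, B) → 0` in `L^r` and all terms lie in `L^r`. [folklore] -/
theorem memLp_bilin {p q r : ℝ≥0∞} [ENNReal.HolderTriple p q r]
    {E₃ : Type*} [NormedAddCommGroup E₃] [NormedSpace ℝ E₃]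
    (β : E₁ →L[ℝ] E₂ →L[ℝ] E₃) {A : X → E₁} {B : X → E₂} (hA : MemLp A p μ) (hB : MemLp B q μ) :
    MemLp (fun x => β (A x) (B x)) r μ := by
  refine ⟨β.continuous₂.comp_aestronglyMeasurable (hA.1.prodMk hB.1), ?_⟩
  refine (eLpNorm_bilin_le (p := p) (q := q) β hA.1 hB.1).trans_lt ?_
  exact ENNReal.mul_lt_top (ENNReal.mul_lt_top ENNReal.coe_lt_top hA.eLpNorm_lt_top)
    hB.eLpNorm_lt_top

end Bilin

/-! ### Functional (vector) weights -/

section ClmWeight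

variable {X : Type*} [MeasurableSpace X] {μ : Measure X}
variable {E₁ E₂ E₃ : Type*} [NormedAddCommGroup E₁] [NormedSpace ℝ E₁] [NormedAddCommGroup E₂]
  [NormedSpace ℝ E₂] [NormedAddCommGroup E₃] [NormedSpace ℝ E₃]

/-- Applying a bounded field of functionals to an integrable field gives an integrable
function. [folklore] -/
theorem integrable_clm_apply_of_bound {w : X → E₃ →L[ℝ] ℝ} {C : ℝ} (hw : AEStronglyMeasurable w μ)
    (hwC : ∀ᵐ x ∂μ, ‖w x‖ ≤ C) {Φ : X → E₃} (hΦ : Integrable Φ μ) :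
    Integrable (fun x => w x (Φ x)) μ := by
  refine Integrable.mono' (hΦ.norm.const_mul C) ?_ ?_
  · exact isBoundedBilinearMap_apply.continuous.comp_aestronglyMeasurable (hw.prodMk hΦ.1)
  · filter_upwards [hwC] with x hx
    exact (le_opNorm _ _).trans (mul_le_mul_of_nonneg_right hx (norm_nonneg _))

/-- **Functional-weighted set integrals pass to `L¹` limits**: if `Φₙ → Φ` in `L¹(μ; E₃)` and
`w` is a bounded a.e.-strongly measurable field of functionals `E₃ →L[ℝ] ℝ`, then
`∫_S w(Φₙ) → ∫_S w(Φ)`. [folklore] -/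
theorem tendsto_setIntegral_clm_apply_of_tendsto_eLpNorm_one {Φ : ℕ → X → E₃} {Φ₀ : X → E₃}
    {w : X → E₃ →L[ℝ] ℝ} {C : ℝ} (hw : AEStronglyMeasurable w μ) (hwC : ∀ᵐ x ∂μ, ‖w x‖ ≤ C)
    (hΦ : ∀ n, Integrable (Φ n) μ) (hΦ₀ : Integrable Φ₀ μ)
    (h : Tendsto (fun n => eLpNorm (Φ n - Φ₀) 1 μ) atTop (𝓝 0)) (S : Set X) :
    Tendsto (fun n => ∫ x in S, w x (Φ n x) ∂μ) atTop (𝓝 (∫ x in S, w x (Φ₀ x) ∂μ)) := by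
  set C' : ℝ≥0 := C.toNNReal with hC'
  have hwC' : ∀ᵐ x ∂μ, ‖w x‖₊ ≤ C' := by
    filter_upwards [hwC] with x hx
    change ‖w x‖ ≤ (C.toNNReal : ℝ)
    exact hx.trans (Real.le_coe_toNNReal C)
  refine tendsto_integral_of_L1 (μ := μ.restrict S) (fun x => w x (Φ₀ x))
    (integrable_clm_apply_of_bound hw hwC hΦ₀).1.restrict (Eventually.of_forall fun n =>
      (integrable_clm_apply_of_bound hw hwC (hΦ n)).restrict) ?_
  have hb : ∀ n, ∫⁻ x in S, ‖w x (Φ n x) - w x (Φ₀ x)‖ₑ ∂μ ≤ C' * eLpNorm (Φ n - Φ₀) 1 μ := by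
    intro n
    rw [eLpNorm_one_eq_lintegral_enorm]
    calc ∫⁻ x in S, ‖w x (Φ n x) - w x (Φ₀ x)‖ₑ ∂μ
        ≤ ∫⁻ x in S, C' * ‖(Φ n - Φ₀) x‖ₑ ∂μ := by
          refine lintegral_mono_ae ((ae_restrict_of_ae hwC').mono fun x hx => ?_)
          rw [← map_sub, Pi.sub_apply]
          refine (ContinuousLinearMap.le_opENorm _ _).trans ?_
          gcongr
          rw [enorm_eq_nnnorm]
          exact_mod_cast hx
      _ = C' * ∫⁻ x in S, ‖(Φ n - Φ₀) x‖ₑ ∂μ := by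
          rw [lintegral_const_mul' _ _ ENNReal.coe_ne_top]
      _ ≤ C' * ∫⁻ x, ‖(Φ n - Φ₀) x‖ₑ ∂μ := by
          gcongr
          exact Measure.restrict_le_self
  have hlim : Tendsto (fun n => (C' : ℝ≥0∞) * eLpNorm (Φ n - Φ₀) 1 μ) atTop (𝓝 0) := by
    simpa using ENNReal.Tendsto.const_mul h (Or.inr ENNReal.coe_ne_top)
  exact tendsto_of_tendsto_of_tendsto_of_le_of_le tendsto_const_nhds hlim (fun n => zero_le) hb

/-- **Functional-weighted integrals of bilinear expressions pass to the limit**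
(version of `tendsto_setIntegral_mul_bilin` for vector-valued `β` and a bounded field of
functionals as weight). [folklore] -/
theorem tendsto_setIntegral_clm_bilin {p q : ℝ≥0∞} [ENNReal.HolderTriple p q 1] (hq : 1 ≤ q)
    (β : E₁ →L[ℝ] E₂ →L[ℝ] E₃) {A : ℕ → X → E₁} {A₀ : X → E₁} {B : ℕ → X → E₂} {B₀ : X → E₂}
    (hA : ∀ n, MemLp (A n) p μ) (hA₀ : MemLp A₀ p μ) (hB : ∀ n, MemLp (B n) q μ)
    (hB₀ : MemLp B₀ q μ)
    (hAt : Tendsto (fun n => eLpNorm (A n - A₀) p μ) atTop (𝓝 0))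
    (hBt : Tendsto (fun n => eLpNorm (B n - B₀) q μ) atTop (𝓝 0))
    {w : X → E₃ →L[ℝ] ℝ} {C : ℝ} (hw : AEStronglyMeasurable w μ) (hwC : ∀ᵐ x ∂μ, ‖w x‖ ≤ C)
    (S : Set X) :
    Tendsto (fun n => ∫ x in S, w x (β (A n x) (B n x)) ∂μ) atTop
      (𝓝 (∫ x in S, w x (β (A₀ x) (B₀ x)) ∂μ)) := by
  refine tendsto_setIntegral_clm_apply_of_tendsto_eLpNorm_one hw hwC
    (fun n => memLp_one_iff_integrable.1 (memLp_bilin (r := 1) β (hA n) (hB n)))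
    (memLp_one_iff_integrable.1 (memLp_bilin (r := 1) β hA₀ hB₀)) ?_ S
  exact tendsto_eLpNorm_bilin_sub (p := p) (q := q) (r := 1) hq le_rfl β
    (fun n => (hA n).1) hA₀.1 (fun n => (hB n).1) hB₀.1 hA₀.eLpNorm_lt_top hB₀.eLpNorm_lt_top
    hAt hBt

/-- Weighted bilinear expressions of `L^p × L^q` fields with a bounded scalar weight are
integrable (`1/p + 1/q = 1`). [folklore] -/
theorem integrable_mul_bilin_of_memLp {p q : ℝ≥0∞} [ENNReal.HolderTriple p q 1]
    (β : E₁ →L[ℝ] E₂ →L[ℝ] ℝ) {A : X → E₁} {B : X → E₂} (hA : MemLp A p μ) (hB : MemLp B q μ)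
    {w : X → ℝ} {C : ℝ} (hw : AEStronglyMeasurable w μ) (hwC : ∀ᵐ x ∂μ, ‖w x‖ ≤ C) :
    Integrable (fun x => w x * β (A x) (B x)) μ :=
  (integrable_bilin_of_memLp β hA hB).bdd_mul hw hwC

/-- Weighted bilinear expressions of `L^p × L^q` fields with a bounded field of functionals as
weight are integrable (`1/p + 1/q = 1`). [folklore] -/
theorem integrable_clm_bilin_of_memLp {p q : ℝ≥0∞} [ENNReal.HolderTriple p q 1]
    (β : E₁ →L[ℝ] E₂ →L[ℝ] E₃) {A : X → E₁} {B : X → E₂} (hA : MemLp A p μ) (hB : MemLp B q μ)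
    {w : X → E₃ →L[ℝ] ℝ} {C : ℝ} (hw : AEStronglyMeasurable w μ) (hwC : ∀ᵐ x ∂μ, ‖w x‖ ≤ C) :
    Integrable (fun x => w x (β (A x) (B x))) μ :=
  integrable_clm_apply_of_bound hw hwC (memLp_one_iff_integrable.1 (memLp_bilin (r := 1) β hA hB))

end ClmWeight

end Literature.Analysis.FluidPDE
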